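import Literature.AlgebraicGeometry.Resolution.TaylorUnitOrderCriterion
import Mathlib.RingTheory.MvPolynomial.Ideal
import Mathlib.RingTheory.MvPowerSeries.NoZeroDivisors
import Mathlib.RingTheory.LocalRing.ResidueField.Basic
import HarnessLib

/-!
# The order criterion by differential operators from a Hasse–Schmidt homomorphism with adapted parameters

Topic: `Literature/AlgebraicGeometry/Resolution`. Abstract local form, valid in every characteristic, of the
classical criterion «`ord_𝔪(h) ≤ N` iff some differential operator of order `≤ N` takes `h` to a unit»
([EGAIV4] §16.8 and Thm. 16.11.2 / [Matsumura1987] §27 for the Hasse–Schmidt calculus; the criterion in the form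
used in resolution of singularities: [VillamayorU2008ReesDiff] §4.1, Remark 4.3).

**Setting.** `O` a local commutative `K`-algebra with maximal ideal `𝔪` and residue field `κ`; a ring
homomorphism `T : O → O⟦t_σ⟧` (`σ` finite) with `constantCoeff ∘ T = id` (a Hasse–Schmidt homomorphism; its
components `D^{[β]} = hsComponent T β`, `TaylorOrderBound.lean`, are differential operators of order `≤ |β|`
relative to any base ring sent to constants, `isDiffOpLE_hsComponentₗ`, `TaylorUnitOrderCriterion.lean`); and
elements `u_i ∈ O` (`i ∈ σ`) GENERATING `𝔪` and ADAPTED to `T` to first order: `D^{[e_j]}(u_i) ≡ δ_ij (mod 𝔪)`.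

* `coeff_prod_pow_of_linearPart`, `coeff_mul_prod_pow_of_linearPart` — bookkeeping in `κ⟦t⟧`: if each `q_i` has
  constant term `0` and linear part `t_i` then `c · ∏ q_i^{γ_i} = c(0) t^γ +` (degree `> |γ|`).
* `mem_maximalIdeal_pow_succ_of_hsComponent_mem` — if `D^{[β]} h ∈ 𝔪` for all `|β| ≤ N` then `h ∈ 𝔪^{N+1}`
  (induction on `N`; the step writes `h ∈ 𝔪^N = (u)^N` as `F(u)` with `F ∈ O[X_σ]` supported in degrees `≥ N`
  — Mathlib `MvPolynomial.mem_pow_idealOfVars_iff` — and reads off the degree-`N` coefficients of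
  `T(h) mod 𝔪 = Σ_γ F̄_γ ∏ q_i^{γ_i}`, which are the residues `F̄_γ`).
* `exists_hsComponent_isUnit_of_mem_of_not_mem` — hence `h ∈ 𝔪^N ∖ 𝔪^{N+1}` ⇒ some `D^{[β]} h`, `|β| = N`, is a
  unit; `order_map_residue_eq` — `T(h) mod 𝔪 ∈ κ⟦t⟧` has order exactly `ord_𝔪(h)`.
* `exists_hsComponent_pow_isUnit`, `exists_isDiffOpLE_isUnit_pow_of_hasseSchmidt`,
  `diffIdeal_span_singleton_pow_eq_top_of_hasseSchmidt` — **unit form for powers**: `h ∈ 𝔪^N ∖ 𝔪^{N+1}` ⇒ for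
  every `e` some `K`-linear differential operator of order `≤ eN` (Grothendieck's sense, the tree's `IsDiffOpLE`)
  takes `h^e` to a unit, and `diffIdeal K (eN) ((h^e)) = ⊤` (`κ⟦t⟧` is a domain: `MvPowerSeries.order_mul`).

No regularity hypothesis is ASSUMED: the existence of `T`-adapted generators of `𝔪` is the input (it forces
`gr_𝔪 O ↪ κ[t_σ]`). The model case `O = k[x]_{(x)}`, `T` = Taylor, `u_i = x_i` is `TaylorUnitOrderCriterion.lean`;
the point of this file is that ANY Hasse–Schmidt homomorphism with first-order-adapted generators of `𝔪` will
do — which is what an étale chart over affine space supplies at a closed point with separable residue field.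
Used by the Hironaka-2017 adjudication cell (`res-hironaka`) towards the clause «Diff^{(md′−md)} g^{d′−d} =
O_{Z,ξ}» (p.27 l.24, typed `Hironaka2017.S05NegativePart.U27L24`); nothing about that manuscript is asserted here.

Sources: [EGAIV4] §16.8, Thm. 16.11.2; [Matsumura1987] §27; [VillamayorU2008ReesDiff] §4.1, Remark 4.3.
-/

noncomputable section

namespace Literature.AlgebraicGeometry.Resolution

open Finsupp IsLocalRing MvPowerSeries

universe u v

section PowerSeriesLemmas

variable {k : Type*} [CommRing k] {σ : Type*} [Fintype σ] [DecidableEq σ]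

omit [Fintype σ] [DecidableEq σ] in
/-- Two multi-indices with `β ≤ γ` and `|γ| ≤ |β|` are equal. [folklore] -/
private theorem eq_of_le_of_degree_le {β γ : σ →₀ ℕ} (hle : β ≤ γ) (hdeg : degree γ ≤ degree β) :
    β = γ := by
  obtain ⟨c, rfl⟩ := exists_add_of_le hle
  have hc : degree c = 0 := by
    rw [map_add] at hdeg
    omega
  rw [degree_eq_zero_iff] at hc
  rw [hc, add_zero]

omit [Fintype σ] [DecidableEq σ] in
/-- A multi-index of degree `1` is a unit vector. [folklore] -/
private theorem exists_eq_single_of_degree_eq_one {β : σ →₀ ℕ} (h : degree β = 1) :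
    ∃ j, β = single j 1 := by
  have hne : β ≠ 0 := fun h0 => by rw [h0, map_zero] at h; exact zero_ne_one h
  obtain ⟨j, hj⟩ := Finsupp.support_nonempty_iff.mpr hne
  refine ⟨j, ?_⟩
  have hle : single j 1 ≤ β :=
    Finsupp.single_le_iff.mpr (Nat.one_le_iff_ne_zero.mpr (Finsupp.mem_support_iff.mp hj))
  exact (eq_of_le_of_degree_le hle (by rw [degree_single, h])).symm

/-- **Products of first-order-adapted series.** If every `q_i ∈ k⟦t_σ⟧` has constant term `0` and linear part
`t_i` (`coeff_{e_j} q_i = δ_ij`), then `∏_i q_i^{γ_i} = t^γ +` (terms of degree `> |γ|`): for `|β| ≤ |γ|`,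
`coeff_β (∏_i q_i^{γ_i}) = [β = γ]`. [folklore] -/
private theorem coeff_prod_pow_of_linearPart (q : σ → MvPowerSeries σ k) (h0 : ∀ i, constantCoeff (q i) = 0)
    (h1 : ∀ i j, coeff (single j 1) (q i) = if i = j then 1 else 0) :
    ∀ (n : ℕ) (γ : σ →₀ ℕ), degree γ = n → ∀ β : σ →₀ ℕ, degree β ≤ n →
      coeff β (∏ i, q i ^ γ i) = if β = γ then 1 else 0
  | 0, γ, hn, β, hβ => by
    have hγ : γ = 0 := (degree_eq_zero_iff γ).mp hn
    have hβ0 : β = 0 := (degree_eq_zero_iff β).mp (Nat.le_zero.mp hβ)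
    subst hγ hβ0
    simp
  | n + 1, γ, hn, β, hβ => by
    -- split off one variable: `γ = γ' + e_i`
    obtain ⟨i, hi⟩ : ∃ i, γ i ≠ 0 := by
      by_contra h
      push Not at h
      have : γ = 0 := Finsupp.ext h
      rw [this, map_zero] at hn
      exact Nat.succ_ne_zero n hn.symm
    have hile : single i 1 ≤ γ := Finsupp.single_le_iff.mpr (Nat.one_le_iff_ne_zero.mpr hi)
    obtain ⟨γ', hγeq⟩ := exists_add_of_le hile
    -- `γ = single i 1 + γ'`
    have hdeg' : degree γ' = n := by
      have := congrArg degree hγeq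
      rw [map_add, degree_single, hn] at this
      omega
    have hprod : (∏ l, q l ^ γ l) = (∏ l, q l ^ γ' l) * q i := by
      rw [hγeq]
      simp only [Finsupp.add_apply, pow_add, Finset.prod_mul_distrib]
      rw [mul_comm]
      congr 1
      rw [Finset.prod_eq_single i (fun l _ hl => by rw [single_eq_of_ne hl, pow_zero])
        (fun h => absurd (Finset.mem_univ i) h), single_eq_same, pow_one]
    rw [hprod, MvPowerSeries.coeff_mul]
    have hterm : ∀ p ∈ Finset.antidiagonal β,
        coeff p.1 (∏ l, q l ^ γ' l) * coeff p.2 (q i) = if p = (γ', single i 1) then 1 else 0 := by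
      intro p hp
      rw [Finset.mem_antidiagonal] at hp
      have hdegβ : degree p.1 + degree p.2 = degree β := by rw [← map_add, hp]
      by_cases h2 : p.2 = 0
      · rw [h2, MvPowerSeries.coeff_zero_eq_constantCoeff, h0, mul_zero, if_neg]
        intro h
        rw [h] at h2
        simp at h2
      by_cases h2' : degree p.2 = 1
      · obtain ⟨j, hj⟩ := exists_eq_single_of_degree_eq_one h2'
        rw [hj, h1]
        by_cases hij : i = j
        · subst hij
          rw [if_pos rfl, mul_one]
          have hdeg1 : degree p.1 ≤ n := by rw [hj, degree_single] at hdegβ; omega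
          rw [coeff_prod_pow_of_linearPart q h0 h1 n γ' hdeg' p.1 hdeg1]
          by_cases hp1 : p.1 = γ'
          · rw [if_pos hp1, if_pos (Prod.ext hp1 hj)]
          · rw [if_neg hp1, if_neg (fun h => hp1 (congrArg Prod.fst h))]
        · rw [if_neg hij, mul_zero, if_neg]
          intro h
          apply hij
          have := congrArg Prod.snd h
          rw [hj] at this
          exact ((Finsupp.single_left_inj one_ne_zero).mp this).symm
      · have h2ge : 2 ≤ degree p.2 := by
          have : degree p.2 ≠ 0 := fun h => h2 ((degree_eq_zero_iff _).mp h)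
          omega
        have hlt : degree p.1 < n := by omega
        rw [coeff_prod_pow_of_linearPart q h0 h1 n γ' hdeg' p.1 hlt.le, if_neg, zero_mul, if_neg]
        · intro h
          have := congrArg Prod.snd h
          rw [this, degree_single] at h2'
          exact h2' rfl
        · intro h
          rw [h, hdeg'] at hlt
          exact lt_irrefl _ hlt
    rw [Finset.sum_congr rfl hterm, Finset.sum_ite_eq']
    by_cases hβγ : β = γ
    · rw [if_pos hβγ, if_pos]
      rw [Finset.mem_antidiagonal, hβγ, hγeq, add_comm]
    · rw [if_neg hβγ, if_neg]
      intro h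
      rw [Finset.mem_antidiagonal] at h
      apply hβγ
      rw [← h, hγeq, add_comm]

/-- **Coefficients of `c · ∏ q_i^{γ_i}` in degrees `≤ |γ|`**: with `q` as in `coeff_prod_pow_of_linearPart` and any
`c ∈ k⟦t⟧`, `coeff_β (c · ∏ q_i^{γ_i}) = [β = γ] · c(0)` for `|β| ≤ |γ|`. [folklore] -/
private theorem coeff_mul_prod_pow_of_linearPart (q : σ → MvPowerSeries σ k) (h0 : ∀ i, constantCoeff (q i) = 0)
    (h1 : ∀ i j, coeff (single j 1) (q i) = if i = j then 1 else 0) (c : MvPowerSeries σ k)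
    {γ β : σ →₀ ℕ} (hβ : degree β ≤ degree γ) :
    coeff β (c * ∏ i, q i ^ γ i) = if β = γ then constantCoeff c else 0 := by
  rw [MvPowerSeries.coeff_mul]
  have hterm : ∀ p ∈ Finset.antidiagonal β,
      coeff p.1 c * coeff p.2 (∏ i, q i ^ γ i) = if p = (0, γ) then constantCoeff c else 0 := by
    intro p hp
    rw [Finset.mem_antidiagonal] at hp
    have hp2le : p.2 ≤ β := by rw [← hp]; exact le_add_self
    have hdeg2 : degree p.2 ≤ degree γ := by
      have : degree p.1 + degree p.2 = degree β := by rw [← map_add, hp]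
      omega
    rw [coeff_prod_pow_of_linearPart q h0 h1 (degree γ) γ rfl p.2 hdeg2]
    by_cases h2 : p.2 = γ
    · -- then `p.2 = β` and `p.1 = 0`
      have hβ2 : p.2 = β := eq_of_le_of_degree_le hp2le (by rw [h2]; exact hβ)
      have h10 : p.1 = 0 := by
        have := hp
        rw [hβ2] at this
        simpa using this
      rw [if_pos h2, mul_one, if_pos (Prod.ext h10 h2), h10, MvPowerSeries.coeff_zero_eq_constantCoeff]
    · rw [if_neg h2, mul_zero, if_neg (fun h => h2 (congrArg Prod.snd h))]
  rw [Finset.sum_congr rfl hterm, Finset.sum_ite_eq']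
  by_cases hβγ : β = γ
  · rw [if_pos hβγ, if_pos]
    rw [Finset.mem_antidiagonal, zero_add, hβγ]
  · rw [if_neg hβγ, if_neg]
    intro h
    rw [Finset.mem_antidiagonal, zero_add] at h
    exact hβγ h.symm

end PowerSeriesLemmas

section LocalCriterion

/-! ## The criterion in a local ring with a Hasse–Schmidt homomorphism and adapted generators of `𝔪` -/

variable {K : Type u} [CommRing K] {O : Type v} [CommRing O] [IsLocalRing O] [Algebra K O]
  {σ : Type*} [Fintype σ] [DecidableEq σ]
  (T : O →+* MvPowerSeries σ O)

omit [Fintype σ] [DecidableEq σ] in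
/-- The coefficients of `T(h) mod 𝔪` are the residues of the Hasse–Schmidt components `D^{[β]} h`. [folklore] -/
private theorem coeff_map_residue_apply (β : σ →₀ ℕ) (h : O) :
    coeff β (MvPowerSeries.map (residue O) (T h)) = residue O (hsComponent T β h) := by
  rw [MvPowerSeries.coeff_map]
  rfl

omit [IsLocalRing O] in
/-- A product `∏ u_i^{d_i}` of elements of an ideal `I` lies in `I^{|d|}`. [folklore] -/
private theorem prod_pow_mem_pow {I : Ideal O} {u : σ → O} (hu : ∀ i, u i ∈ I) (d : σ →₀ ℕ) :
    (∏ i, u i ^ d i) ∈ I ^ degree d := by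
  rw [degree_eq_sum]
  induction (Finset.univ : Finset σ) using Finset.induction_on with
  | empty => simp
  | insert a s ha ih =>
    rw [Finset.prod_insert ha, Finset.sum_insert ha, pow_add]
    exact Ideal.mul_mem_mul (Ideal.pow_mem_pow (hu a) _) ih

omit [Fintype σ] [DecidableEq σ] in
/-- `D^{[β]}(𝔪^{N+1}) ⊆ 𝔪` for `|β| ≤ N` (Leibniz rule; `hsComponent_mem_pow`). [cite: Matsumura1987, §27] -/
theorem hsComponent_mem_maximalIdeal_of_mem_pow (hT0 : ∀ b, constantCoeff (T b) = b) {N : ℕ} {h : O}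
    (hh : h ∈ maximalIdeal O ^ (N + 1)) {β : σ →₀ ℕ} (hβ : degree β ≤ N) :
    hsComponent T β h ∈ maximalIdeal O := by
  have := hsComponent_mem_pow T hT0 (maximalIdeal O) (N + 1) β hh
  exact Ideal.pow_le_self (by omega) this

/-- **`D^{[β]} h ∈ 𝔪` for all `|β| ≤ N` implies `h ∈ 𝔪^{N+1}`** — for a Hasse–Schmidt homomorphism `T` of the local
`K`-algebra `O` (`constantCoeff ∘ T = id`) and generators `u_i` of `𝔪` adapted to `T` to first order
(`D^{[e_j]} u_i ≡ δ_ij mod 𝔪`). Induction on `N`: writing `h ∈ 𝔪^N = (u)^N` as `F(u)` with `F ∈ O[X_σ]` supported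
in degrees `≥ N`, the degree-`N` coefficients of `T(h) mod 𝔪 = Σ_γ F̄_γ ∏ (t_i + O(t²))^{γ_i}` are the residues
`F̄_γ`; if they vanish, `h ∈ 𝔪·(u)^N + (u)^{N+1} = 𝔪^{N+1}`. [cite: Matsumura1987, §27 (higher derivations)]
[cite: VillamayorU2008ReesDiff, §4.1 and Remark 4.3] -/
theorem mem_maximalIdeal_pow_succ_of_hsComponent_mem (hT0 : ∀ b, constantCoeff (T b) = b) {u : σ → O}
    (hu : Ideal.span (Set.range u) = maximalIdeal O)
    (hlin : ∀ i j, hsComponent T (single j 1) (u i) - (if i = j then 1 else 0) ∈ maximalIdeal O) :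
    ∀ (N : ℕ) (h : O), (∀ β : σ →₀ ℕ, degree β ≤ N → hsComponent T β h ∈ maximalIdeal O) →
      h ∈ maximalIdeal O ^ (N + 1) := by
  -- the reduced series `q_i = T(u_i) mod 𝔪` have constant term `0` and linear part `t_i`
  have hu𝔪 : ∀ i, u i ∈ maximalIdeal O := fun i => hu ▸ Ideal.subset_span ⟨i, rfl⟩
  have hq0 : ∀ i, constantCoeff (MvPowerSeries.map (residue O) (T (u i))) = 0 := by
    intro i
    rw [← MvPowerSeries.coeff_zero_eq_constantCoeff_apply, coeff_map_residue_apply, hsComponent_zero T hT0,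
      residue_eq_zero_iff]
    exact hu𝔪 i
  have hq1 : ∀ i j, coeff (single j 1) (MvPowerSeries.map (residue O) (T (u i))) = if i = j then 1 else 0 := by
    intro i j
    rw [coeff_map_residue_apply]
    have := hlin i j
    rw [← Ideal.Quotient.eq_zero_iff_mem, map_sub, sub_eq_zero] at this
    -- `residue` is `Ideal.Quotient.mk (maximalIdeal O)`
    change Ideal.Quotient.mk (maximalIdeal O) _ = _
    by_cases hij : i = j
    · rw [if_pos hij] at this ⊢
      rw [this, map_one]
      exact rfl
    · rw [if_neg hij] at this ⊢
      rw [this, map_zero]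
      exact rfl
  -- `𝔪 = (u)` as the image of the ideal of variables under evaluation at `u`
  have hmap : (MvPolynomial.idealOfVars σ O).map (MvPolynomial.eval u) = maximalIdeal O := by
    rw [MvPolynomial.idealOfVars, Ideal.map_span, ← Set.range_comp, ← hu]
    congr 1
    ext x
    simp
  intro N
  induction N with
  | zero =>
    intro h hD
    have := hD 0 (by simp)
    rwa [hsComponent_zero T hT0, ← pow_one (maximalIdeal O)] at this
  | succ N ih =>
    intro h hD
    have hN : h ∈ maximalIdeal O ^ (N + 1) := ih h fun β hβ => hD β (Nat.le_succ_of_le hβ)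
    -- write `h = F(u)` with `F` supported in degrees `≥ N+1`
    rw [← hmap, ← Ideal.map_pow, Ideal.mem_map_iff_of_surjective _
      (fun a => ⟨MvPolynomial.C a, MvPolynomial.eval_C a⟩)] at hN
    obtain ⟨F, hF, hFh⟩ := hN
    rw [MvPolynomial.mem_pow_idealOfVars_iff] at hF
    -- the degree-`(N+1)` coefficients of `T(h) mod 𝔪` are the residues of the coefficients of `F`
    have hcoeff : ∀ β : σ →₀ ℕ, degree β = N + 1 →
        coeff β (MvPowerSeries.map (residue O) (T h)) = residue O (MvPolynomial.coeff β F) := by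
      intro β hβ
      have hev : MvPowerSeries.map (residue O) (T h) =
          MvPolynomial.eval₂ ((MvPowerSeries.map (residue O)).comp T)
            (fun i => MvPowerSeries.map (residue O) (T (u i))) F := by
        rw [← hFh, MvPolynomial.eval, MvPolynomial.coe_eval₂Hom, ← RingHom.comp_apply,
          MvPolynomial.eval₂_comp_left]
        rfl
      rw [hev, MvPolynomial.eval₂_eq', map_sum]
      have hterm : ∀ d ∈ F.support,
          coeff β (((MvPowerSeries.map (residue O)).comp T) (MvPolynomial.coeff d F) *
            ∏ i, MvPowerSeries.map (residue O) (T (u i)) ^ d i) =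
          if β = d then residue O (MvPolynomial.coeff d F) else 0 := by
        intro d hd
        rw [coeff_mul_prod_pow_of_linearPart _ hq0 hq1 _ (by rw [hβ]; exact hF d hd)]
        split_ifs
        · rw [RingHom.comp_apply, ← MvPowerSeries.coeff_zero_eq_constantCoeff_apply, coeff_map_residue_apply,
            hsComponent_zero T hT0]
        · rfl
      rw [Finset.sum_congr rfl hterm, Finset.sum_ite_eq]
      split_ifs with hmem
      · rfl
      · rw [MvPolynomial.notMem_support_iff.mp hmem, map_zero]
    -- hence those coefficients of `F` lie in `𝔪`
    have hFc : ∀ β : σ →₀ ℕ, degree β = N + 1 → MvPolynomial.coeff β F ∈ maximalIdeal O := by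
      intro β hβ
      rw [← residue_eq_zero_iff, ← hcoeff β hβ, coeff_map_residue_apply, residue_eq_zero_iff]
      exact hD β hβ.le
    -- and `h = Σ_d F_d u^d ∈ 𝔪^{N+2}`
    rw [← hFh, MvPolynomial.eval_eq']
    refine Ideal.sum_mem _ fun d hd => ?_
    have hdeg : N + 1 ≤ degree d := hF d hd
    rcases hdeg.eq_or_lt with heq | hlt
    · rw [pow_succ']
      exact Ideal.mul_mem_mul (hFc d heq.symm) (by simpa [← heq] using prod_pow_mem_pow hu𝔪 d)
    · exact Ideal.mul_mem_left _ _ (Ideal.pow_le_pow_right (by omega) (prod_pow_mem_pow hu𝔪 d))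

/-- **Unit form.** Under the same hypotheses, if `h ∈ 𝔪^N ∖ 𝔪^{N+1}` then some Hasse–Schmidt component
`D^{[β]} h` with `|β| = N` is a UNIT of `O`. [cite: VillamayorU2008ReesDiff, §4.1 and Remark 4.3] -/
theorem exists_hsComponent_isUnit_of_mem_of_not_mem (hT0 : ∀ b, constantCoeff (T b) = b) {u : σ → O}
    (hu : Ideal.span (Set.range u) = maximalIdeal O)
    (hlin : ∀ i j, hsComponent T (single j 1) (u i) - (if i = j then 1 else 0) ∈ maximalIdeal O)
    {N : ℕ} {h : O} (h1 : h ∈ maximalIdeal O ^ N) (h2 : h ∉ maximalIdeal O ^ (N + 1)) :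
    ∃ β : σ →₀ ℕ, degree β = N ∧ IsUnit (hsComponent T β h) := by
  by_contra hne
  push Not at hne
  apply h2
  refine mem_maximalIdeal_pow_succ_of_hsComponent_mem T hT0 hu hlin N h fun β hβ => ?_
  rcases hβ.eq_or_lt with heq | hlt
  · exact (mem_maximalIdeal _).mpr (mem_nonunits_iff.mpr (hne β heq))
  · cases N with
    | zero => exact absurd hlt (Nat.not_lt_zero _)
    | succ N => exact hsComponent_mem_maximalIdeal_of_mem_pow T hT0 h1 (by omega)

/-- **`T(h) mod 𝔪` has order exactly `ord_𝔪(h)`**: for `h ∈ 𝔪^N ∖ 𝔪^{N+1}` the reduced series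
`Σ_β (D^{[β]} h mod 𝔪) t^β ∈ κ⟦t⟧` has order `N`. [cite: Matsumura1987, §27 (higher derivations)] -/
theorem order_map_residue_eq (hT0 : ∀ b, constantCoeff (T b) = b) {u : σ → O}
    (hu : Ideal.span (Set.range u) = maximalIdeal O)
    (hlin : ∀ i j, hsComponent T (single j 1) (u i) - (if i = j then 1 else 0) ∈ maximalIdeal O)
    {N : ℕ} {h : O} (h1 : h ∈ maximalIdeal O ^ N) (h2 : h ∉ maximalIdeal O ^ (N + 1)) :
    (MvPowerSeries.map (residue O) (T h)).order = N := by
  classical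
  rw [MvPowerSeries.order_eq_nat]
  constructor
  · obtain ⟨β, hβ, hunit⟩ := exists_hsComponent_isUnit_of_mem_of_not_mem T hT0 hu hlin h1 h2
    refine ⟨β, ?_, hβ⟩
    rw [coeff_map_residue_apply, Ne, residue_eq_zero_iff]
    exact fun hmem => (mem_maximalIdeal _).mp hmem hunit
  · intro β hβ
    rw [coeff_map_residue_apply, residue_eq_zero_iff]
    cases N with
    | zero => exact absurd hβ (Nat.not_lt_zero _)
    | succ N => exact hsComponent_mem_maximalIdeal_of_mem_pow T hT0 h1 (by omega)

/-- **Powers**: for `h ∈ 𝔪^N ∖ 𝔪^{N+1}` and every `e`, some component `D^{[δ]}(h^e)` with `|δ| = eN` is a unit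
(the residue field power series ring is a domain, `MvPowerSeries.order_mul`). [cite: Matsumura1987, §27] -/
theorem exists_hsComponent_pow_isUnit (hT0 : ∀ b, constantCoeff (T b) = b) {u : σ → O}
    (hu : Ideal.span (Set.range u) = maximalIdeal O)
    (hlin : ∀ i j, hsComponent T (single j 1) (u i) - (if i = j then 1 else 0) ∈ maximalIdeal O)
    {N : ℕ} {h : O} (h1 : h ∈ maximalIdeal O ^ N) (h2 : h ∉ maximalIdeal O ^ (N + 1)) (e : ℕ) :
    ∃ δ : σ →₀ ℕ, degree δ = e * N ∧ IsUnit (hsComponent T δ (h ^ e)) := by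
  classical
  have hGord := order_map_residue_eq T hT0 hu hlin h1 h2
  have hGe : ∀ e : ℕ, ((MvPowerSeries.map (residue O) (T h)) ^ e).order = ((e * N : ℕ) : ℕ∞) := by
    intro e
    induction e with
    | zero =>
      rw [pow_zero, Nat.zero_mul, MvPowerSeries.order_eq_nat]
      refine ⟨⟨0, ?_, by simp⟩, fun d hd => absurd hd (Nat.not_lt_zero _)⟩
      rw [MvPowerSeries.coeff_zero_one]; exact one_ne_zero
    | succ e ih =>
      rw [pow_succ, MvPowerSeries.order_mul, ih, hGord, Nat.succ_mul, Nat.cast_add]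
  have hfin : (((MvPowerSeries.map (residue O) (T h)) ^ e).order).toNat
      = ((MvPowerSeries.map (residue O) (T h)) ^ e).order := by
    rw [hGe e, ENat.toNat_coe]
  obtain ⟨δ, hδ, hδdeg⟩ := MvPowerSeries.exists_coeff_ne_zero_and_order hfin
  refine ⟨δ, ?_, ?_⟩
  · rw [hGe e] at hδdeg
    exact_mod_cast hδdeg
  · rw [← map_pow, ← map_pow, coeff_map_residue_apply, Ne, residue_eq_zero_iff] at hδ
    by_contra hnot
    exact hδ ((mem_maximalIdeal _).mpr (mem_nonunits_iff.mpr hnot))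

/-- **Unit form of the order criterion, every characteristic.** Let `O` be a local commutative `K`-algebra with a
Hasse–Schmidt homomorphism `T : O → O⟦t_σ⟧` (`constantCoeff ∘ T = id`, `T` sending `K` to constants) and
generators `u_i` of `𝔪` adapted to `T` to first order (`D^{[e_j]} u_i ≡ δ_ij mod 𝔪`). If `h ∈ 𝔪^N ∖ 𝔪^{N+1}`,
then for every `e` some `K`-linear differential operator of `O` of order `≤ eN` (Grothendieck's sense,
`IsDiffOpLE`) takes `h^e` to a UNIT — a component `D^{[δ]}`, `|δ| = eN`, which is a differential operator of
order `≤ |δ|` by `isDiffOpLE_hsComponentₗ`. [cite: EGAIV4, §16.8 and Thm. 16.11.2]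
[cite: VillamayorU2008ReesDiff, §4.1 and Remark 4.3] -/
theorem exists_isDiffOpLE_isUnit_pow_of_hasseSchmidt (hT0 : ∀ b, constantCoeff (T b) = b)
    (hTK : ∀ c : K, T (algebraMap K O c) = MvPowerSeries.C (algebraMap K O c)) {u : σ → O}
    (hu : Ideal.span (Set.range u) = maximalIdeal O)
    (hlin : ∀ i j, hsComponent T (single j 1) (u i) - (if i = j then 1 else 0) ∈ maximalIdeal O)
    {N : ℕ} {h : O} (h1 : h ∈ maximalIdeal O ^ N) (h2 : h ∉ maximalIdeal O ^ (N + 1)) (e : ℕ) :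
    ∃ D : O →ₗ[K] O, IsDiffOpLE K (e * N) D ∧ IsUnit (D (h ^ e)) := by
  obtain ⟨δ, hδ, hunit⟩ := exists_hsComponent_pow_isUnit T hT0 hu hlin h1 h2 e
  exact ⟨hsComponentₗ T hTK δ, hδ ▸ isDiffOpLE_hsComponentₗ T hTK hT0 (degree δ) δ le_rfl, hunit⟩

/-- **`Diff^{≤ eN}_{O/K}((h^e)) = O`** for `h` of `𝔪`-adic order exactly `N`, in the setting of
`exists_isDiffOpLE_isUnit_pow_of_hasseSchmidt` (the tree's `diffIdeal`). [cite: VillamayorU2008ReesDiff, §4.1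
and Remark 4.3] -/
theorem diffIdeal_span_singleton_pow_eq_top_of_hasseSchmidt (hT0 : ∀ b, constantCoeff (T b) = b)
    (hTK : ∀ c : K, T (algebraMap K O c) = MvPowerSeries.C (algebraMap K O c)) {u : σ → O}
    (hu : Ideal.span (Set.range u) = maximalIdeal O)
    (hlin : ∀ i j, hsComponent T (single j 1) (u i) - (if i = j then 1 else 0) ∈ maximalIdeal O)
    {N : ℕ} {h : O} (h1 : h ∈ maximalIdeal O ^ N) (h2 : h ∉ maximalIdeal O ^ (N + 1)) (e : ℕ) :
    diffIdeal K (e * N) (Ideal.span {h ^ e}) = ⊤ := by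
  obtain ⟨D, hD, hunit⟩ := exists_isDiffOpLE_isUnit_pow_of_hasseSchmidt T hT0 hTK hu hlin h1 h2 e
  exact Ideal.eq_top_of_isUnit_mem _ (apply_mem_diffIdeal K hD (Ideal.mem_span_singleton_self _)) hunit

end LocalCriterion

end Literature.AlgebraicGeometry.Resolution

end
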